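import Mathlib
import HarnessLib
import Literature.NumberTheory.Transcendental.PeriodsWave0
import Summits.KontsevichZagierPeriods.Zeta5Search.Denom.TwoTaleP15Decay
import Summits.KontsevichZagierPeriods.Zeta5Search.Denom.TwoTaleP15Bridge
import Summits.KontsevichZagierPeriods.Zeta5Search.Denom.TwoTaleP15StripShift
import Summits.KontsevichZagierPeriods.Zeta5Search.Denom.KernelSechSq
import Summits.KontsevichZagierPeriods.Zeta5Search.Denom.KernelBinomialMoment
import Summits.KontsevichZagierPeriods.Zeta5Search.Denom.KernelPolarMoment
import Summits.KontsevichZagierPeriods.Zeta5Search.TwoTaleP15LineRepAlgebra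

/-!
# Two-tale P15 — the line representation `rₙ = −(1/2πi)∫ (π/sin πt)² R(t − a₂*) dt` is a THEOREM
# (D16, task E3: linearity half + assembly with the algebraic half)

HONEST FRAMING: systematic search; no irrationality claim unless certified. This file certifies NO
irrationality measure, NO decay rate and NO line bound. It DISCHARGES one named input of the P15 decay side:
the `@[conjecture]` sub-input `LineRep` of `Denom/TwoTaleP15Decay` is proved (`lineRep_holds`).

Source: [Zudilin2014ZetaTwo] W. Zudilin, *Two hypergeometric tales and a new irrationality measure of
`ζ(2)`*, Ann. Math. Québec **38** (2014) 101–117, arXiv:1310.1526 — Proposition 1, eqs. (P4)–(P5):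
`rₙ = qₙ ζ(2) − pₙ = (−1)^d (1/2πi) ∫_{Re t = x} (π/sin πt)² R(t − a₂*) dt`, obtained from the decomposition
(P1)–(P3) of `R`, Barnes-type Lemma 1 (`(1/2πi)∫ (π/sin πt)² (t−1)⋯(t−ℓ)/ℓ! dt = (−1)^ℓ/(ℓ+1)`) and
Lemma 2 (`(1/2πi)∫ (π/sin πt)² dt/(t+k) = ζ(2) − Σ_{ℓ≤k} ℓ⁻²`). At P15 `d = 16n − 1` is odd and `a₂* = 11n+1`.

What is PROVED here (0 `sorry`, standard axioms):

* `kernel_integral_expansion` — LINEARITY: for finite index sets, natural shifts `κ k` and complex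
  coefficients `c k`, `a l`, the kernel line integral on `Re t = ½` of
  `Σ_k c_k/(t + κ_k) + Σ_l a_l P_l(t)` (`P_l(t) = (t−1)⋯(t−l)/l!`, tree `KernelBinomialMoment.barnesP`)
  equals `Σ_k c_k (ζ(2) − Σ_{i≤κ_k} i⁻²) + Σ_l a_l (−1)^l/(l+1)`: every term is integrable against the
  profile `π²/cosh²(πy)` (tree `KernelSechSq.integrable_sechSq_mul`), the integral splits term by term, and
  the tree's in-kernel Lemmas 1–2 (`KernelBinomialMoment.kernelMoment_eq` = [Zudilin2014ZetaTwo, Lemma 1],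
  `KernelPolarMoment.polarLine_half_eq` = [Zudilin2014ZetaTwo, Lemma 2]) evaluate the pieces.
* `ratRC_polar_newton` — the ALGEBRAIC half (P1)–(P3) at P15 in this family's coordinates:
  `R(t − a₂*) = Σ_{k=15n+1}^{26n+1} C_k/(t − a₂* + k) + Σ_{l<16n} A_l P_l(t)` with `C_k = TwoTaleP15Forms.coefC`,
  `A_l = TwoTaleP15Forms.newtonA`. This is the tree theorem `TwoTaleP15.ratRC_shift_eq` (P1 g9,
  `Zeta5Search/TwoTaleP15LineRepAlgebra`: [Zudilin2014ZetaTwo, (P1)–(P3)] over `ℂ`) transported through the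
  coefficient bridge `Denom/TwoTaleP15Bridge` (`coefC_eq`, `coefA_eq`; its hypothesis `hP` = the tree's
  `Zudilin2014.R_eq_polyP_add_polar_full` at the integers `m ≥ −11n`, proved here as `polyP_eval_intCast`).
* `lineIntegral_half_eq`, **`lineRep_holds : TwoTaleP15Decay.LineRep`** — `qₙ ζ(2) − pₙ = −(1/2π)∫_ℝ (π/sin π(½+iy))²
  R(½ − a₂* + iy) dy` for every `n ≥ 1`.
* **`decay_of_halfLineBound`** — with the tree's `TwoTaleP15StripShift.stripShift_holds`, the decay input `Decay c` of
  `Denom/TwoTaleP15Forms` now follows from ONE explicit eventual bound for a vertical-line integral of `|R|`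
  against `π²/cosh²` (no other hypothesis); `zetaTwo_exponent_le_of_halfLineBound` is the loose end-to-end corollary
  (`c = 29.10` ⇒ exponent `≤ 5.0523`, CONDITIONAL on `Inclusion`, the line bound and `CoeffRate`).

NOT claimed: `Inclusion`, `CoeffRate`, any line bound, any value of `c`, any irrationality measure.
-/

noncomputable section

open Complex Set MeasureTheory Filter Topology Finset
open Literature.NumberTheory.Transcendental
open Literature.NumberTheory.Irrationality
open Summit.KontsevichZagierPeriods.Zeta5Search
open Summit.KontsevichZagierPeriods.Zeta5Search.Denom.TwoTaleP15Saving
open Summit.KontsevichZagierPeriods.Zeta5Search.Denom.TwoTaleP15Forms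
open Summit.KontsevichZagierPeriods.Zeta5Search.Denom.TwoTaleP15Decay
open Summit.KontsevichZagierPeriods.Zeta5Search.Denom.KernelStripStep
open Summit.KontsevichZagierPeriods.Zeta5Search.Denom.KernelSechSq
open Summit.KontsevichZagierPeriods.Zeta5Search.Denom.KernelBinomialMoment
open Summit.KontsevichZagierPeriods.Zeta5Search.Denom.KernelPolarMoment

namespace Summit.KontsevichZagierPeriods.Zeta5Search.Denom.TwoTaleP15LineRep

/-! ### The line `Re t = ½`: kernel profile, strip membership, integrability of the polar test function -/

/-- `cos(π/2) = 0`: on `Re t = ½` the kernel `(π/sin πt)²` is the real profile `π²/cosh²(πy)`. -/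
theorem cos_pi_mul_half : Real.cos (Real.pi * (1 / 2)) = 0 := by
  rw [show Real.pi * (1 / 2) = Real.pi / 2 by ring, Real.cos_pi_div_two]

/-- The kernel on the line `Re t = ½`: `(π/sin π(½+iy))² = π²/cosh²(πy)`. -/
theorem kernelSq_half (y : ℝ) : kernelSq (((1 / 2 : ℝ) : ℂ) + (y : ℂ) * I) = ((sechSq y : ℝ) : ℂ) :=
  kernel_halfLine cos_pi_mul_half y

/-- The point `½ + iy` lies in the closed strip `|Re t − 1| ≤ ½`. -/
theorem half_line_mem_halfStrip (y : ℝ) :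
    (((1 / 2 : ℝ) : ℂ) + (y : ℂ) * I) ∈ halfStrip ((1 : ℕ) : ℤ) := by
  have hre : (((1 / 2 : ℝ) : ℂ) + (y : ℂ) * I).re = 1 / 2 := by simp
  simp only [halfStrip, Set.mem_preimage, Set.mem_Icc, hre]
  norm_num

/-- On the line: `(½ + iy) − a₂* + k = (½ + iy) + (k − a₂*)` with `k − a₂* : ℕ` once `k ≥ 15n + 1 > a₂* = 11n + 1`. -/
theorem line_shift_eq (n k : ℕ) (hk : 15 * n + 1 ≤ k) (s : ℂ) :
    s - (11 * n + 1) + k = s + ((k - (11 * n + 1) : ℕ) : ℂ) := by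
  rw [Nat.cast_sub (by omega)]
  push_cast
  ring

/-- On the line `Re t = ½` no shifted pole is met: `(½ + iy) − a₂* + k ≠ 0` for `15n+1 ≤ k ≤ 26n+1`. -/
theorem line_shift_ne_zero (n : ℕ) (y : ℝ) :
    ∀ k ∈ Finset.Ico (15 * n + 1) (26 * n + 2), (((1 / 2 : ℝ) : ℂ) + (y : ℂ) * I) - (11 * n + 1) + k ≠ 0 := by
  intro k hk
  rw [line_shift_eq n k (Finset.mem_Ico.1 hk).1]
  exact add_natCast_ne_zero le_rfl (half_line_mem_halfStrip y)

/-- `y ↦ π²/cosh²(πy) · (½ + iy + k)⁻¹` is integrable (the test function has growth exponent `0`). -/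
theorem integrable_sechSq_mul_inv (k : ℕ) :
    Integrable fun y : ℝ => ((sechSq y : ℝ) : ℂ) * (1 / ((((1 / 2 : ℝ) : ℂ) + (y : ℂ) * I) + k)) := by
  refine integrable_sechSq_mul (A := 2) (N := 0) ?_ ?_
  · have hne : ∀ y : ℝ, (((1 / 2 : ℝ) : ℂ) + (y : ℂ) * I) + k ≠ 0 := fun y =>
      add_natCast_ne_zero le_rfl (half_line_mem_halfStrip y)
    exact continuous_const.div (by fun_prop) hne
  · intro y
    have h := norm_inv_add_natCast_le (m := 1) (k := k) le_rfl _ (half_line_mem_halfStrip y)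
    have him : (((1 / 2 : ℝ) : ℂ) + (y : ℂ) * I).im = y := by simp
    rw [him] at h
    exact h

/-! ### Linearity of the kernel line integral over a finite polar + Newton expansion -/

/-- **LINEARITY.** For finite index sets `K`, `L`, natural shifts `κ k` and coefficients `c k`, `a l`:
`(1/2π) ∫_ℝ (π/sin π(½+iy))² (Σ_{k∈K} c_k/(½+iy+κ_k) + Σ_{l∈L} a_l P_l(½+iy)) dy
   = Σ_{k∈K} c_k (ζ(2) − Σ_{i≤κ_k} i⁻²) + Σ_{l∈L} a_l (−1)^l/(l+1)`
(`kernelSq t = (π/sin πt)²` of `Denom/TwoTaleP15Decay`; every summand is integrable against `π²/cosh²(πy)`; then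
[Zudilin2014ZetaTwo, Lemmas 1–2] in kernel form: `KernelPolarMoment.polarLine_half_eq`, `KernelBinomialMoment.kernelMoment_eq`). -/
theorem kernel_integral_expansion (K L : Finset ℕ) (κ : ℕ → ℕ) (c a : ℕ → ℂ) :
    (1 / (2 * Real.pi) : ℂ) * ∫ y : ℝ, kernelSq (((1 / 2 : ℝ) : ℂ) + (y : ℂ) * I) *
        (∑ k ∈ K, c k / ((((1 / 2 : ℝ) : ℂ) + (y : ℂ) * I) + (κ k : ℕ)) +
          ∑ l ∈ L, a l * barnesP l (((1 / 2 : ℝ) : ℂ) + (y : ℂ) * I)) =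
      ∑ k ∈ K, c k * (((zetaValue 2 - ∑ i ∈ range (κ k + 1), (1 : ℝ) / (i : ℝ) ^ 2 : ℝ) : ℂ)) +
        ∑ l ∈ L, a l * ((-1) ^ l / (l + 1)) := by
  have hfun : (fun y : ℝ => kernelSq (((1 / 2 : ℝ) : ℂ) + (y : ℂ) * I) *
        (∑ k ∈ K, c k / ((((1 / 2 : ℝ) : ℂ) + (y : ℂ) * I) + (κ k : ℕ)) +
          ∑ l ∈ L, a l * barnesP l (((1 / 2 : ℝ) : ℂ) + (y : ℂ) * I))) =
      fun y : ℝ => ∑ k ∈ K, c k * (((sechSq y : ℝ) : ℂ) * (1 / ((((1 / 2 : ℝ) : ℂ) + (y : ℂ) * I) + (κ k : ℕ)))) +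
        ∑ l ∈ L, a l * (((sechSq y : ℝ) : ℂ) * barnesP l (((1 / 2 : ℝ) : ℂ) + (y : ℂ) * I)) := by
    funext y
    rw [kernelSq_half y, mul_add, mul_sum, mul_sum]
    congr 1 <;> refine sum_congr rfl fun _ _ => ?_ <;> ring
  have hIk : ∀ k ∈ K, Integrable fun y : ℝ =>
      c k * (((sechSq y : ℝ) : ℂ) * (1 / ((((1 / 2 : ℝ) : ℂ) + (y : ℂ) * I) + (κ k : ℕ)))) :=
    fun k _ => (integrable_sechSq_mul_inv (κ k)).const_mul (c k)
  have hIl : ∀ l ∈ L, Integrable fun y : ℝ =>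
      a l * (((sechSq y : ℝ) : ℂ) * barnesP l (((1 / 2 : ℝ) : ℂ) + (y : ℂ) * I)) :=
    fun l _ => (integrable_kernelMoment l).const_mul (a l)
  have hP : ∀ k : ℕ, ∫ y : ℝ, ((sechSq y : ℝ) : ℂ) * (1 / ((((1 / 2 : ℝ) : ℂ) + (y : ℂ) * I) + (κ k : ℕ))) =
      2 * Real.pi * (((zetaValue 2 - ∑ i ∈ range (κ k + 1), (1 : ℝ) / (i : ℝ) ^ 2 : ℝ) : ℂ)) := by
    intro k
    have h := polarLine_half_eq (κ k)
    unfold polarLine at h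
    exact h
  have hM : ∀ l : ℕ, ∫ y : ℝ, ((sechSq y : ℝ) : ℂ) * barnesP l (((1 / 2 : ℝ) : ℂ) + (y : ℂ) * I) =
      2 * Real.pi * ((-1) ^ l / (l + 1)) := by
    intro l
    have h := kernelMoment_eq l
    unfold kernelMoment at h
    exact h
  rw [hfun, integral_add (integrable_finsetSum K hIk) (integrable_finsetSum L hIl),
    integral_finsetSum K hIk, integral_finsetSum L hIl]
  simp only [integral_const_mul, hP, hM]
  have hπ : (Real.pi : ℂ) ≠ 0 := by exact_mod_cast Real.pi_ne_zero
  have h2π : (2 * Real.pi : ℂ) ≠ 0 := mul_ne_zero two_ne_zero hπ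
  have key : ∀ u v : ℂ, (1 / (2 * Real.pi) : ℂ) * (u * (2 * Real.pi * v)) = u * v := by
    intro u v
    rw [show (1 / (2 * Real.pi) : ℂ) * (u * (2 * Real.pi * v)) = (1 / (2 * Real.pi) * (2 * Real.pi) : ℂ) * (u * v) by
      ring, one_div_mul_cancel h2π, one_mul]
  rw [mul_add, mul_sum, mul_sum]
  exact congrArg₂ (· + ·) (sum_congr rfl fun k _ => key _ _) (sum_congr rfl fun l _ => key _ _)

/-! ### The algebraic half at P15 in this family's coordinates (from `TwoTaleP15.ratRC_shift_eq`) -/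

/-- The two parameter transcriptions of P15 agree definitionally: `TwoTaleP15.aP15 = TwoTaleP15Bridge.pA`. -/
theorem aP15_eq_pA (n : ℕ) : TwoTaleP15.aP15 n = TwoTaleP15Bridge.pA n := rfl

/-- `TwoTaleP15.bP15 = TwoTaleP15Bridge.pB`. -/
theorem bP15_eq_pB (n : ℕ) : TwoTaleP15.bP15 n = TwoTaleP15Bridge.pB n := rfl

/-- Eq. (P1)–(P2) at the integers `m ≥ −11n` (no pole there): `P(m) = R(m) − Σ_{k ∈ [15n+1, 26n+2)} C_k/(m+k)`
— the tree's `Zudilin2014.R_eq_polyP_add_polar_full` at P15; this is hypothesis `hP` of `Denom/TwoTaleP15Bridge`. -/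
theorem polyP_eval_intCast {n : ℕ} (hn : 1 ≤ n) :
    ∀ m : ℤ, -(11 * (n : ℤ)) ≤ m → (Zudilin2014.polyP (TwoTaleP15Bridge.pA n) (TwoTaleP15Bridge.pB n)).eval (m : ℚ) =
      Zudilin2014.R (TwoTaleP15Bridge.pA n) (TwoTaleP15Bridge.pB n) m -
        ∑ k ∈ Ico (TwoTaleP15Bridge.pA n 3) (TwoTaleP15Bridge.pB n 3),
          Zudilin2014.coefC (TwoTaleP15Bridge.pA n) (TwoTaleP15Bridge.pB n) k / ((m : ℚ) + k) := by
  intro m hm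
  have hadm : Zudilin2014.Admissible (TwoTaleP15Bridge.pA n) (TwoTaleP15Bridge.pB n) := TwoTaleP15.admissible hn
  have ht : ∀ k ∈ Finset.Ico (TwoTaleP15Bridge.pA n 3) (TwoTaleP15Bridge.pB n 3), (m : ℚ) + k ≠ 0 := by
    intro k hk
    rw [TwoTaleP15Bridge.pA_three, TwoTaleP15Bridge.pB_three, Finset.mem_Ico] at hk
    have h0 : (0 : ℤ) < m + k := by omega
    have h1 : (0 : ℚ) < (m : ℚ) + k := by exact_mod_cast h0
    exact h1.ne'
  rw [Zudilin2014.R_eq_polyP_add_polar_full hadm ht]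
  ring

/-- **(P1)–(P3) at P15, family coordinates.** For `n ≥ 1` and every complex `t` off the shifted poles:
`R(t − a₂*) = Σ_{k=15n+1}^{26n+1} C_k/(t − a₂* + k) + Σ_{l=0}^{16n−1} A_l · (t−1)⋯(t−l)/l!` with `a₂* = 11n+1`,
`C_k = TwoTaleP15Forms.coefC n k`, `A_l = TwoTaleP15Forms.newtonA n l` — the tree theorem `TwoTaleP15.ratRC_shift_eq`
([Zudilin2014ZetaTwo, (P1)–(P3)] over `ℂ`, P1) through the bridge `TwoTaleP15Bridge.coefC_eq` / `coefA_eq`. -/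
theorem ratRC_polar_newton {n : ℕ} (hn : 1 ≤ n) (t : ℂ)
    (ht : ∀ k ∈ Finset.Ico (15 * n + 1) (26 * n + 2), t - (11 * n + 1) + k ≠ 0) :
    ratRC n (t - (11 * n + 1)) =
      ∑ k ∈ Finset.Ico (15 * n + 1) (26 * n + 2), (coefC n k : ℂ) / (t - (11 * n + 1) + k) +
        ∑ l ∈ Finset.range (16 * n), ((newtonA n l : ℚ) : ℂ) * barnesP l t := by
  have e1 : (15 * (n : ℤ) + 1) = ((15 * n + 1 : ℕ) : ℤ) := by push_cast; ring
  have e2 : (26 * (n : ℤ) + 2) = ((26 * n + 2 : ℕ) : ℤ) := by push_cast; ring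
  have hIco : Finset.Ico (15 * (n : ℤ) + 1) (26 * n + 2) =
      (Finset.Ico (15 * n + 1) (26 * n + 2)).map Nat.castEmbedding := by
    rw [e1, e2, TwoTaleP15Bridge.Ico_natCast_eq_map]
  have htZ : ∀ k ∈ Finset.Ico (15 * (n : ℤ) + 1) (26 * n + 2), t - (11 * n + 1) + (k : ℂ) ≠ 0 := by
    intro k hk
    rw [hIco, Finset.mem_map] at hk
    obtain ⟨m, hm, rfl⟩ := hk
    rw [Nat.castEmbedding_apply, Int.cast_natCast]
    exact ht m hm
  rw [TwoTaleP15.ratRC_shift_eq hn t htZ, hIco, Finset.sum_map, aP15_eq_pA, bP15_eq_pB]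
  congr 1
  · refine sum_congr rfl fun m hm => ?_
    have hm' := Finset.mem_Ico.1 hm
    rw [Nat.castEmbedding_apply, Int.cast_natCast, TwoTaleP15Bridge.coefC_eq hm'.1 (by omega), Rat.cast_intCast]
  · refine sum_congr rfl fun l _ => ?_
    rw [TwoTaleP15Bridge.coefA_eq (polyP_eval_intCast hn) (TwoTaleP15.a2star_eq n) l]
    rfl

/-! ### The line representation at P15 -/

/-- **The line integral at `x = ½`, evaluated term by term**:
`(1/2π) ∫_ℝ (π/sin π(½+iy))² R(½ − a₂* + iy) dy = Σ_k C_k (ζ(2) − Σ_{i ≤ k−a₂*} i⁻²) + Σ_l A_l (−1)^l/(l+1)`. -/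
theorem lineIntegral_half_eq {n : ℕ} (hn : 1 ≤ n) :
    lineIntegral n (1 / 2) =
      ∑ k ∈ Ico (15 * n + 1) (26 * n + 2), (coefC n k : ℂ) *
          (((zetaValue 2 - ∑ i ∈ range (k - (11 * n + 1) + 1), (1 : ℝ) / (i : ℝ) ^ 2 : ℝ) : ℂ)) +
        ∑ l ∈ range (16 * n), ((newtonA n l : ℚ) : ℂ) * ((-1) ^ l / (l + 1)) := by
  have hfun : (fun y : ℝ => kernelSq (((1 / 2 : ℝ) : ℂ) + (y : ℂ) * I) *
        ratRC n (((1 / 2 : ℝ) : ℂ) - (11 * n + 1) + (y : ℂ) * I)) =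
      fun y : ℝ => kernelSq (((1 / 2 : ℝ) : ℂ) + (y : ℂ) * I) *
        (∑ k ∈ Ico (15 * n + 1) (26 * n + 2),
            (coefC n k : ℂ) / ((((1 / 2 : ℝ) : ℂ) + (y : ℂ) * I) + ((k - (11 * n + 1) : ℕ) : ℂ)) +
          ∑ l ∈ range (16 * n), ((newtonA n l : ℚ) : ℂ) * barnesP l (((1 / 2 : ℝ) : ℂ) + (y : ℂ) * I)) := by
    funext y
    have harg : ((1 / 2 : ℝ) : ℂ) - (11 * n + 1) + (y : ℂ) * I =
        (((1 / 2 : ℝ) : ℂ) + (y : ℂ) * I) - (11 * n + 1) := by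
      ring
    rw [harg, ratRC_polar_newton hn _ (line_shift_ne_zero n y)]
    congr 2
    refine sum_congr rfl fun k hk => ?_
    rw [line_shift_eq n k (Finset.mem_Ico.1 hk).1]
  unfold lineIntegral
  rw [hfun]
  exact kernel_integral_expansion (Ico (15 * n + 1) (26 * n + 2)) (range (16 * n)) (fun k => k - (11 * n + 1))
    (fun k => (coefC n k : ℂ)) (fun l => ((newtonA n l : ℚ) : ℂ))

/-- Harmonic bookkeeping: `Σ_{i ∈ range (m+1)} i⁻² = Σ_{l ∈ Icc 1 m} l⁻²` (the `i = 0` term is `1/0 = 0`). -/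
theorem sum_range_succ_inv_sq_eq_Icc (m : ℕ) :
    ∑ i ∈ range (m + 1), (1 : ℝ) / (i : ℝ) ^ 2 = ∑ l ∈ Icc 1 m, (1 : ℝ) / (l : ℝ) ^ 2 := by
  induction m with
  | zero => simp
  | succ m ih => rw [sum_range_succ, ih, sum_Icc_succ_top (by omega : 1 ≤ m + 1)]

/-- The coefficient side in closed form: `qₙ ζ(2) − pₙ = −(Σ_k C_k (ζ(2) − Σ_{l=1}^{k−a₂*} l⁻²) + Σ_l A_l (−1)^l/(l+1))`
(definitions `formQ = −Σ_k C_k`, `formP = −(Σ_k C_k H⁽²⁾_{k−a₂*} − Σ_l (−1)^l A_l/(l+1))`, cast to `ℂ`). -/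
theorem formQ_zeta_sub_formP_eq (n : ℕ) :
    (formQ n : ℂ) * ((zetaValue 2 : ℝ) : ℂ) - ((formP n : ℚ) : ℂ) =
      -(∑ k ∈ Ico (15 * n + 1) (26 * n + 2), (coefC n k : ℂ) *
            (((zetaValue 2 - ∑ l ∈ Icc 1 (k - (11 * n + 1)), (1 : ℝ) / (l : ℝ) ^ 2 : ℝ) : ℂ)) +
          ∑ l ∈ range (16 * n), ((newtonA n l : ℚ) : ℂ) * ((-1) ^ l / (l + 1))) := by
  have hU : ∑ l ∈ range (16 * n), ((newtonA n l : ℚ) : ℂ) * ((-1) ^ l / (l + 1)) =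
      ∑ l ∈ range (16 * n), (-1) ^ l * ((newtonA n l : ℚ) : ℂ) / (l + 1) :=
    sum_congr rfl fun l _ => by ring
  rw [hU]
  simp only [formQ, formP]
  push_cast
  simp only [mul_sub, sum_sub_distrib, ← sum_mul]
  ring

/-- **`LineRep` IS A THEOREM** ([Zudilin2014ZetaTwo, Prop. 1, (P4)–(P5)] at P15: (P1)–(P3) + linearity +
Lemmas 1–2 in kernel form): `qₙ ζ(2) − pₙ = −(1/2π) ∫_ℝ (π/sin π(½+iy))² R(½ − a₂* + iy) dy` for every `n ≥ 1`. -/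
theorem lineRep_holds : LineRep := by
  intro n hn
  rw [lineIntegral_half_eq hn, formQ_zeta_sub_formP_eq]
  simp only [sum_range_succ_inv_sq_eq_Icc]

/-! ### Consequences for the decay input -/

/-- **`Decay c` from ONE line bound.** With `lineRep_holds` and the tree's `stripShift_holds`, the `@[conjecture]`
input `Decay c` of `Denom/TwoTaleP15Forms` follows from an explicit eventual bound
`(π/2) ∫_ℝ |R(xₙ + ½ − a₂* + iy)| / cosh²(πy) dy ≤ e^{−cn}` on ONE half-integer line `xₙ + ½`, `xₙ ≤ 9n`
(tree `TwoTaleP15Decay.decay_of_lineBound` with both of its named inputs discharged). -/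
theorem decay_of_halfLineBound {c : ℝ} (x : ℕ → ℕ) (hx : ∀ n, x n ≤ 9 * n)
    (hB : ∀ᶠ n : ℕ in atTop, Real.pi / 2 *
      ∫ y : ℝ, ‖ratRC n ((((x n : ℝ) + 1 / 2 : ℝ) : ℂ) - (11 * n + 1) + (y : ℂ) * I)‖ /
        Real.cosh (Real.pi * y) ^ 2 ≤ Real.exp (-(c * n))) :
    Decay c :=
  TwoTaleP15Decay.decay_of_lineBound lineRep_holds TwoTaleP15StripShift.stripShift_holds x hx hB

/-- **End-to-end, loose constants (CONDITIONAL on the named inputs).** `Inclusion`, a line bound with `c = 29.10`,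
and `CoeffRate C₁` with `0 < C₁ ≤ 42.04` give `μ(ζ(2)) ≤ 5.0523` (tree `TwoTaleP15Decay.zetaTwo_exponent_le_loose`).
Nothing but `LineRep`/`StripShift` is discharged on this route; NOT an irrationality-measure certificate. -/
theorem zetaTwo_exponent_le_of_halfLineBound {C₁ : ℝ} (hI : Inclusion) (x : ℕ → ℕ) (hx : ∀ n, x n ≤ 9 * n)
    (hB : ∀ᶠ n : ℕ in atTop, Real.pi / 2 *
      ∫ y : ℝ, ‖ratRC n ((((x n : ℝ) + 1 / 2 : ℝ) : ℂ) - (11 * n + 1) + (y : ℂ) * I)‖ /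
        Real.cosh (Real.pi * y) ^ 2 ≤ Real.exp (-(29.10 * n)))
    (hC : CoeffRate C₁) (hC₀ : 0 < C₁) (hC₁ : C₁ ≤ 42.04) : ExponentLE (zetaValue 2) 5.0523 :=
  zetaTwo_exponent_le_loose hI (decay_of_halfLineBound x hx hB) hC hC₀ hC₁

end Summit.KontsevichZagierPeriods.Zeta5Search.Denom.TwoTaleP15LineRep

end
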